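import Mathlib
import Summits.NavierStokesRegularity.NavierStokesRegularity.Theorems.EulerZoomLiouvillePowerGaugeEulerLiouvilleIrrotational
import Summits.NavierStokesRegularity.NavierStokesRegularity.Theorems.EulerZoomLiouvillePowerGaugeEulerLiouvillePastSymmetric
import Summits.NavierStokesRegularity.NavierStokesRegularity.Theorems.EulerZoomLiouvillePowerGaugeEulerLiouvilleFrozenDirectionSlice
import Summits.NavierStokesRegularity.NavierStokesRegularity.Theorems.EulerZoomLiouvillePowerGaugeEulerLiouvilleFrozenDirectionFlatSlice
import Literature.Analysis.FluidPDE.NSBoundedSpatialHolder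
import Literature.Analysis.FluidPDE.VectorCalculus
import HarnessLib.Audit

/-!
# Crux E `PowerGaugeEulerLiouville` (stmt-NavierStokesRegularity-19832): members with a FROZEN VORTICITY DIRECTION on a far past are trivial
# (line `frozen-direction` assembled at member level: F1 ∘ F2, weak class)

Route `EulerZoomLiouville` (NavierStokesRegularity), crux E.  Line `frozen-direction` (crux dir
`Cruxes/PowerGaugeEulerLiouville/Lines/frozen-direction.md`, ns-idea-11 g2 — Giga–Miura's continuous-alignment programme on the Euler side):
a member of Seregin's power-gauged class (`ρ > 0`) whose weak spatial gradient `H` has a FROZEN DIRECTION `e(τ) ≠ 0` on a past sub-slab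
`(−∞, T₁)`, `T₁ ≤ 0` — `⟪H(τ,x) e(τ), w⟫ = ⟪H(τ,x) w, e(τ)⟫` for a.e. `(τ,x)` and all `w` (the vorticity matrix annihilates `e(τ)`; classically
`curl u(τ,·) ∥ e(τ)`) — vanishes a.e. on the whole slab (`FrozenDirection.ae_eq_zero_of_gauge_of_pastFrozenDirection`).  This file is the
MEMBER-LEVEL assembly of the line's two slice lemmas, both landed: F1 `FrozenDirection.ae_apply_eq_zero_of_pairing_traceFree_of_growth`
(interim LEAD ns-typeII-p2 g10, p610704: no variation along `e`) and F2 `FrozenDirection.flatSlice_ae_eq_zero` (width seat ns-ezl-w1, p611392: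
an `e`-invariant slice with growth exponent `< 1` vanishes by packing), following the line file's kernel-checked composition
`ae_eq_zero_of_gauge_of_pastFrozenDirection` verbatim: good far-past slices (`ae_hasWeakGradient_slice_of_slab`, trace-free by
`SerrinBoundedHolder.ae_trace_eq_zero`, `A`-gauge growth `r^{1−2ρ}` by `hasScaledLocalEnergyBound_of_gauge`) vanish, and the far-past filler
`PastSymmetric.ae_eq_zero_of_gauge_of_pastSlicesZero` concludes.  Contains the tree's weakly-irrotational past stratum
(`PastWeak.ae_eq_zero_of_gauge_of_pastWeaklyIrrotational`: a symmetric `H` freezes every direction).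
WHAT THIS IS NOT: not NS regularity, not the crux E — one weak-class stratum for the lead skeleton (interim LEAD ns-typeII-p2 g10).
[folklore; GigaMiura2011 Thm 1.1 (motivation); line card `Lines/frozen-direction.md`]
-/

noncomputable section

set_option linter.dupNamespace false

open MeasureTheory Set Filter Topology Metric Function
open scoped ENNReal NNReal InnerProductSpace RealInnerProductSpace

namespace Summit.NavierStokesRegularity.NavierStokesRegularity.Theorems.PowerGaugeEulerLiouville.FrozenDirection

open Literature.Analysis Literature.Analysis.FunctionSpaces Literature.Analysis.FluidPDE
open Summit.NavierStokesRegularity.NavierStokesRegularity.Theorems.PowerGaugeEulerLiouville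

/-- **MEMBERS WITH A FROZEN VORTICITY DIRECTION ON A FAR PAST ARE TRIVIAL** (line `frozen-direction`, F1 ∘ F2 at member level).
Crux hypotheses verbatim (`ρ > 0`) + a past sub-slab `(−∞, T₁)`, `T₁ ≤ 0`, and directions `e(τ) ≠ 0` with
`⟪H(τ,x) e(τ), w⟫ = ⟪H(τ,x) w, e(τ)⟫` for a.e. `(τ, x) ∈ (−∞,T₁) × ℝ³` and all `w` ⇒ `u = 0` a.e. on `(−∞, 0) × ℝ³`.
[folklore; line card `Cruxes/PowerGaugeEulerLiouville/Lines/frozen-direction.md`] -/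
theorem ae_eq_zero_of_gauge_of_pastFrozenDirection {ρ : ℝ} (hρ : 0 < ρ)
    {u : ℝ → EuclideanSpace ℝ (Fin 3) → EuclideanSpace ℝ (Fin 3)} {p : ℝ → EuclideanSpace ℝ (Fin 3) → ℝ}
    {H : ℝ → EuclideanSpace ℝ (Fin 3) → EuclideanSpace ℝ (Fin 3) →L[ℝ] EuclideanSpace ℝ (Fin 3)} {c : ℝ≥0}
    (hsw : IsSuitableWeakSolutionOn (slab (EuclideanSpace ℝ (Fin 3)) (Iio 0) isOpen_Iio) 0 0 u p)
    (hH : HasWeakSpatialGradientOn (slab (EuclideanSpace ℝ (Fin 3)) (Iio 0) isOpen_Iio) u H)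
    (hc : ∀ a : ℝ, 0 < a →
      ENNReal.ofReal (a ^ (2 * ρ)) * cknA a (0 : ℝ × EuclideanSpace ℝ (Fin 3)) u +
          ENNReal.ofReal (a ^ ρ) * cknE a (0 : ℝ × EuclideanSpace ℝ (Fin 3)) H +
        ENNReal.ofReal (a ^ (2 * ρ)) * cknD a (0 : ℝ × EuclideanSpace ℝ (Fin 3)) p ≤ (c : ℝ≥0∞))
    {T₁ : ℝ} (hT₁ : T₁ ≤ 0) {e : ℝ → EuclideanSpace ℝ (Fin 3)} (he : ∀ τ : ℝ, e τ ≠ 0)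
    (hfro : ∀ᵐ z ∂(volume.restrict (Iio T₁ ×ˢ (univ : Set (EuclideanSpace ℝ (Fin 3))))),
      ∀ w : EuclideanSpace ℝ (Fin 3), ⟪H z.1 z.2 (e z.1), w⟫ = ⟪H z.1 z.2 w, e z.1⟫) :
    uncurry u =ᵐ[volume.restrict (Iio (0 : ℝ) ×ˢ (univ : Set (EuclideanSpace ℝ (Fin 3))))] 0 := by
  -- adapted from `Cruxes/PowerGaugeEulerLiouville/Lines/frozen_direction.lean` (`ae_eq_zero_of_gauge_of_pastFrozenDirection`, ns-idea-11 g2)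
  have hA := hasScaledLocalEnergyBound_of_gauge hc
  -- good far-past times: weak gradient slice, frozen pairing, trace-free
  have h1 : ∀ᵐ t ∂(volume.restrict (Iio T₁)), HasWeakGradient (u t) (H t) :=
    ae_restrict_of_ae_restrict_of_subset (Iio_subset_Iio hT₁) (ae_hasWeakGradient_slice_of_slab hH)
  have h2 : ∀ᵐ t ∂(volume.restrict (Iio T₁)), ∀ᵐ x ∂(volume : Measure (EuclideanSpace ℝ (Fin 3))),
      ∀ w : EuclideanSpace ℝ (Fin 3), ⟪H t x (e t), w⟫ = ⟪H t x w, e t⟫ := by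
    have hμ : (volume : Measure (ℝ × EuclideanSpace ℝ (Fin 3))).restrict (Iio T₁ ×ˢ (univ : Set (EuclideanSpace ℝ (Fin 3)))) =
        (volume.restrict (Iio T₁)).prod (volume : Measure (EuclideanSpace ℝ (Fin 3))) := by
      rw [Measure.volume_eq_prod, Measure.restrict_prod_eq_prod_univ]
    rw [hμ] at hfro
    exact Measure.ae_ae_of_ae_prod hfro
  have h3 : ∀ᵐ t ∂(volume.restrict (Iio T₁)), ∀ᵐ x ∂(volume : Measure (EuclideanSpace ℝ (Fin 3))),
      ∑ j, H t x (EuclideanSpace.single j (1 : ℝ)) j = 0 := by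
    have htr := SerrinBoundedHolder.ae_trace_eq_zero hsw.distributional hH
    refine ae_restrict_of_ae_restrict_of_subset (Iio_subset_Iio hT₁)
      (ae_ae_slice_of_ae_slab (P := fun t x => ∑ j, H t x (EuclideanSpace.single j (1 : ℝ)) j = 0) ?_)
    rw [ae_restrict_iff' (measurableSet_Iio.prod MeasurableSet.univ)]
    filter_upwards [htr] with z hz hmem
    exact hz (by simpa [slab] using hmem)
  have ht1 : ∀ᵐ t ∂(volume.restrict (Iio T₁)), t < T₁ := by
    rw [ae_restrict_iff' measurableSet_Iio]; exact Eventually.of_forall fun t ht => ht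
  -- every good far-past slice vanishes: F1 then F2
  have hslice : ∀ᵐ t ∂(volume.restrict (Iio T₁)), u t =ᵐ[volume] 0 := by
    filter_upwards [h1, h2, h3, ht1] with t h1 h2 h3 ht
    have ht0 : t < 0 := lt_of_lt_of_le ht hT₁
    have hgrowth : ∀ r : ℝ, Real.sqrt (-t) < r → 0 < r →
        ∫⁻ x in ball (0 : EuclideanSpace ℝ (Fin 3)) r, ‖u t x‖ₑ ^ 2 ≤ ENNReal.ofReal ((c : ℝ) * r ^ (1 - 2 * ρ)) := by
      intro r hr hr0
      have hs : t ∈ Ioo (-(r ^ 2)) 0 := by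
        refine ⟨?_, ht0⟩
        have h4 : Real.sqrt (-t) ^ 2 = -t := Real.sq_sqrt (by linarith)
        nlinarith [Real.sqrt_nonneg (-t)]
      exact hA r hr0 t hs
    have hflat := ae_apply_eq_zero_of_pairing_traceFree_of_growth (u t) (H t) h1 h3 (e t) h2 (c : ℝ) (1 - 2 * ρ)
      (Real.sqrt (-t)) (by linarith) hgrowth
    exact flatSlice_ae_eq_zero (u t) (H t) h1 (e t) (he t) hflat (c : ℝ) (1 - 2 * ρ) (Real.sqrt (-t)) (by linarith) hgrowth
  -- far-past slices have zero energy; the far-past filler concludes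
  have hzero : ∀ᵐ τ ∂(volume.restrict (Iio T₁)), ∫⁻ x, ‖u τ x‖ₑ ^ 2 = 0 := by
    filter_upwards [hslice] with τ hτ
    have hτ' : (fun x => ‖u τ x‖ₑ ^ 2) =ᵐ[volume] fun _ => 0 := by
      filter_upwards [hτ] with x hx
      simp [hx]
    rw [lintegral_congr_ae hτ']
    simp
  exact PastSymmetric.ae_eq_zero_of_gauge_of_pastSlicesZero hρ.le hsw hH hc hzero

end Summit.NavierStokesRegularity.NavierStokesRegularity.Theorems.PowerGaugeEulerLiouville.FrozenDirection
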